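import Summits.ResolutionOfSingularities.ResolutionOfSingularities.Theorems.WeightedInvariantHypersurfaceLocalGameEFT4SDimLEDoorGradedHom
import Summits.ResolutionOfSingularities.ResolutionOfSingularities.Theorems.WeightedInvariantIotaMaxStratum
import Summits.ResolutionOfSingularities.ResolutionOfSingularities.Theorems.WeightedInvariantHypersurfaceGenericPointOffSingImage
import HarnessLib

/-!
# E-ladder rung `e = 2`: the generic point of the hypersurface is off every canonical (and every admissible) centre

[OURS · L1 W4.3 · DOOR `HypersurfaceCentreConstruction` (stmt-ResolutionOfSingularities-19897) · E2 CENTRE piece (C-d)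
of the registrar's SPEC (Δ9) `L/res-L1-w43-plan-1/E2Step_split_sketch.lean` rev 3 (sha16 3dbfad7a331aa48b), ORDER/OFFER (o47-d)
«QUICK WIN (S, def-free)»; written by res-L1-type-o6 (gen 29) as an idle-pool hand.  Def-free kernel lemmas; `--supports` the
door item as a helper.  Replaces the role of: nothing printed — OURS bookkeeping of the E-ladder, NOT a statement of the
manuscript [Hironaka2017] or of any manuscript under adjudication; candidates not facts; AI work, weaker than expert review.]

The piece (C-d) `E2GenericOffSupportBody p ι J` of SPEC (Δ9) reads: for every stage `S` over a perfect field of characteristic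
`p` and every Rees algebra `R` on `S.Y`, `S.IsCanonicalCentre₂ ι J R → S.i (genericPoint S.X) ∉ R.support`.  It is rung-free,
field-free and two tree lemmas deep:

* `support R = closure (maxLocus₂ ι) ⊆ closure (singImage S.i.ker) = singImage S.i.ker` — `IsCanonicalCentre₂.support_eq`,
  `maxLocus₂_subset_singImage` (…ELadderTwoStage) and `isClosed_singImage S.f` (…IotaMaxStratum: `Y` is locally of finite type
  over `k`, being smooth);
* the image of the generic point of the integral `S.X` is not in `singImage S.i.ker` (its local ring is the function field) —
  the tree's `not_mem_singImage_ker_apply_genericPoint` / `apply_genericPoint_not_mem_of_subset_singImage`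
  (…HypersurfaceGenericPointOffSingImage, the [S2] kernel of the H2c″ assembly; the `hξ` block of
  `ELadderOne.e1_assembly_unconditional` is the same argument inline).

Landed here:
* `Stage.apply_genericPoint_not_mem_singImage` / `…_closure_singImage`, `Stage.closure_maxLocus₂_subset_singImage`,
  `Stage.IsCanonicalCentre₂.support_subset_singImage` (sharpens the tree's `.support_subset`, which only gives the closure);
* **`Stage.IsCanonicalCentre₂.apply_genericPoint_not_mem_support`** — (C-d) for one stage, over ANY field;
* `Stage.apply_genericPoint_not_mem_support_of_isAdmissibleCentre` — the same conclusion from ADMISSIBILITY alone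
  (`IsAdmissibleCentre` carries `(iii-b′) supp R ⊆ singImage`), so the conjunct `S.i (genericPoint S.X) ∉ R.support` of
  `E2CentreBody` is redundant next to `IsAdmissibleCentre S.f S.i.ker R`;
* **`LocalEngine.e2GenericOffSupport p ι J`** — the body of `E2GenericOffSupportBody p ι J` VERBATIM (the registrar's word is not
  yet a tree declaration; once it is, `hd` of `E2CentreBody_of_pieces` / `stub_e2_centre_h_of_pieces` is this theorem by `Iff.rfl`);
* `LocalEngine.e2CentreBody_of_forall_exists_admissible_canonical` / `…e2CentreH_of_…` — `E2CentreBody` / `E2CentreH` from the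
  three remaining pieces' joint conclusion «∃ R, admissible ∧ canonical» (the (C-d) slot closes itself).
-/

noncomputable section

set_option linter.dupNamespace false -- mandated namespace of this single-conjunct summit

open CategoryTheory AlgebraicGeometry TopologicalSpace IsLocalRing
open Literature.AlgebraicGeometry.Resolution
open Summit.ResolutionOfSingularities.ResolutionOfSingularities.Theorems

namespace Summit.ResolutionOfSingularities.ResolutionOfSingularities.Theorems.ELadderOne.Stage

variable {k : Type} [Field k]

/-- The image of the generic point of the stage's (integral) hypersurface `S.X` is not in the non-regular image
`singImage S.i.ker` (its local ring is the function field, a regular local ring). [OURS] [folklore] -/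
theorem apply_genericPoint_not_mem_singImage (S : Stage k) : S.i (genericPoint S.X) ∉ singImage S.i.ker :=
  not_mem_singImage_ker_apply_genericPoint S.i

/-- … nor in its closure: `singImage S.i.ker` is closed, `S.Y` being locally of finite type over `k` (smooth).
[OURS] [folklore] -/
theorem apply_genericPoint_not_mem_closure_singImage (S : Stage k) :
    S.i (genericPoint S.X) ∉ closure (singImage S.i.ker) := by
  rw [(isClosed_singImage S.f S.i.ker).closure_eq]
  exact S.apply_genericPoint_not_mem_singImage

/-- The CLOSURE of the rung-2 maximum locus still lies in the (closed) non-regular image. [OURS] [folklore] -/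
theorem closure_maxLocus₂_subset_singImage (ι : (R : Type) → [CommRing R] → R → Ordinal.{0}) (S : Stage k) :
    closure (S.maxLocus₂ ι) ⊆ singImage S.i.ker :=
  (isClosed_singImage S.f S.i.ker).closure_subset_iff.mpr (S.maxLocus₂_subset_singImage ι)

/-- The support of a canonical e = 2 centre lies in the non-regular image itself (sharpens `.support_subset`,
which gives the closure). [OURS] [folklore] -/
theorem IsCanonicalCentre₂.support_subset_singImage {ι : (R : Type) → [CommRing R] → R → Ordinal.{0}}
    {J : (R : Type) → [CommRing R] → R → ℕ → Ideal R} {S : Stage k} {R : ReesAlgebraData S.Y}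
    (hR : S.IsCanonicalCentre₂ ι J R) : R.support ⊆ singImage S.i.ker := by
  rw [hR.support_eq]
  exact S.closure_maxLocus₂_subset_singImage ι

/-- **(C-d) for one stage, over any field**: the image of the generic point of `S.X` is off the support of every
canonical e = 2 centre. [OURS] [folklore] -/
theorem IsCanonicalCentre₂.apply_genericPoint_not_mem_support {ι : (R : Type) → [CommRing R] → R → Ordinal.{0}}
    {J : (R : Type) → [CommRing R] → R → ℕ → Ideal R} {S : Stage k} {R : ReesAlgebraData S.Y}
    (hR : S.IsCanonicalCentre₂ ι J R) : S.i (genericPoint S.X) ∉ R.support :=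
  apply_genericPoint_not_mem_of_subset_singImage S.i hR.support_subset_singImage

/-- The same conclusion from ADMISSIBILITY alone: an admissible centre has `supp R ⊆ singImage` by `(iii-b′)`.
[OURS] [folklore] -/
theorem apply_genericPoint_not_mem_support_of_isAdmissibleCentre (S : Stage k) {R : ReesAlgebraData S.Y}
    (hadm : IsAdmissibleCentre S.f S.i.ker R) : S.i (genericPoint S.X) ∉ R.support :=
  apply_genericPoint_not_mem_support_of_support_subset_singImage S.i R hadm.2.1

end Summit.ResolutionOfSingularities.ResolutionOfSingularities.Theorems.ELadderOne.Stage

namespace Summit.ResolutionOfSingularities.ResolutionOfSingularities.Cruxes.HypersurfaceCentreConstruction.LocalEngine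

open Summit.ResolutionOfSingularities.ResolutionOfSingularities.Theorems.ELadderOne

/-- **(C-d) `E2GenericOffSupportBody p ι J`, body VERBATIM** (registrar SPEC (Δ9), ORDER (o47-d)): for every stage over a
perfect field of characteristic `p` and every Rees algebra `R` on its ambient, a canonical e = 2 centre structure on `R`
puts the image of the generic point of the hypersurface off `supp R`.  (Neither `CharP` nor `PerfectField` nor `p` is
used.) [OURS] [folklore] -/
theorem e2GenericOffSupport (p : ℕ) (ι : (R : Type) → [CommRing R] → R → Ordinal.{0})
    (J : (R : Type) → [CommRing R] → R → ℕ → Ideal R) :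
    ∀ ⦃k : Type⦄ [Field k] [CharP k p] [PerfectField k] (S : Stage k) (R : ReesAlgebraData S.Y),
      S.IsCanonicalCentre₂ ι J R → S.i (genericPoint S.X) ∉ R.support :=
  fun _ _ _ _ _ _ hR => hR.apply_genericPoint_not_mem_support

/-- **The (C-d) slot of `E2CentreBody` closes itself**: if every non-regular stage with (I0)₂ carries an ADMISSIBLE canonical
e = 2 centre (the joint conclusion of the pieces (C-a)/(C-b)/(C-c) of SPEC (Δ9)), then `E2CentreBody p ι J` holds — the
generic-point conjunct follows from admissibility. [OURS] [folklore] -/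
theorem e2CentreBody_of_forall_exists_admissible_canonical (p : ℕ) (ι : (R : Type) → [CommRing R] → R → Ordinal.{0})
    (J : (R : Type) → [CommRing R] → R → ℕ → Ideal R)
    (h : ∀ ⦃k : Type⦄ [Field k] [CharP k p] [PerfectField k] (S : Stage k), S.InvDim₂ → ¬ Scheme.IsRegular S.X →
      ∃ R : ReesAlgebraData S.Y, IsAdmissibleCentre S.f S.i.ker R ∧ S.IsCanonicalCentre₂ ι J R) :
    E2CentreBody p ι J := by
  intro k _ _ _ S hI hreg
  obtain ⟨R, hadm, hcan⟩ := h S hI hreg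
  exact ⟨R, hadm, S.apply_genericPoint_not_mem_support_of_isAdmissibleCentre hadm, hcan⟩

/-- Rung form of the previous lemma: `E2CentreH p ι J` (skeleton v3.11's `stub_e2_centre_h` at `(p, ι, J)`) from
«graded HOM rung ⇒ every non-regular stage with (I0)₂ carries an admissible canonical e = 2 centre». [OURS] [folklore] -/
theorem e2CentreH_of_forall_exists_admissible_canonical (p : ℕ) (ι : (R : Type) → [CommRing R] → R → Ordinal.{0})
    (J : (R : Type) → [CommRing R] → R → ℕ → Ideal R)
    (h : PRungGrHomLE 3 p ι J →
      ∀ ⦃k : Type⦄ [Field k] [CharP k p] [PerfectField k] (S : Stage k), S.InvDim₂ → ¬ Scheme.IsRegular S.X →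
        ∃ R : ReesAlgebraData S.Y, IsAdmissibleCentre S.f S.i.ker R ∧ S.IsCanonicalCentre₂ ι J R) :
    E2CentreH p ι J :=
  fun hr => e2CentreBody_of_forall_exists_admissible_canonical p ι J (h hr)

end Summit.ResolutionOfSingularities.ResolutionOfSingularities.Cruxes.HypersurfaceCentreConstruction.LocalEngine

end
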